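import Mathlib.Algebra.Group.Even
import Mathlib.Tactic.Linarith
import Mathlib.Tactic.Abel
import Mathlib.Tactic.Group
import Literature.Combinatorics.Additive.TripleProductProperty
import Summits.MatrixMultiplication.OmegaCensus.DihedralLikeTPPBound
import HarnessLib

/-!
# The `c₀`-shifted triangle relations of a TPP triple in a dihedral-like group

ω-census, family (b3).  Framing: lottery ticket; floor = certified bounds/negative ranges.

In a group with a dihedral-like presentation `ρ, τ : A → G` (`ρaρb = ρ(a+b)`, `ρaτb = τ(b−a)`, `τaρb = τ(a+b)`,
`τaτb = ρ(c₀+b−a)`) the inverse of a "reflection" is `(τ a)⁻¹ = τ(a − c₀)`.  Reading the TPP relation on the mixed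
quotients in the *other* order (`τb'(ρb)⁻¹ = τ(b'−b)` instead of `ρb(τb')⁻¹ = τ(b−b'−c₀)`… ) shows that the two
sumset triangles `{S₁+T₀+U₀, S₀+T₁+U₀, S₀+T₀+U₁}` and `{S₀+T₁+U₁, S₁+T₀+U₁, S₁+T₁+U₀}` of a TPP triple are not only
pairwise disjoint (`DihedralLikeTPPBound.lean`) but pairwise disjoint *from each other's `c₀`-translates*
(`shifted_disjoint₁'/₂'/₃'`).  For generalized dihedral groups (`c₀ = 0`) this says nothing new; for the dicyclic
groups (`2c₀ = 0 ≠ c₀`, e.g. `Q_{4n}` with `A = ZMod 2n`, `c₀ = n`) it says that the `c₀`-saturations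
`X ∪ (X + c₀)` of the three parts of each triangle are pairwise disjoint (`sat_counting'`), which is the extra input
behind `β(Q_{4n}) = 8⌊2n/3⌋` for `n ≡ 1 (mod 3)` (`DicyclicLawModOne.lean`).  Also recorded: elementary facts on
`c₀`-saturations and `c₀`-periodic sets (`periodic_of_card_sat_eq`, `exists_insert_of_card_sat`,
`even_card_of_periodic`).
-/

namespace Summit.MatrixMultiplication.OmegaCensus

open Literature.Combinatorics.Additive Finset

section DihedralLike

variable {A : Type*} {G : Type*} {ρ τ : A → G} {c₀ : A}

section Shifted

variable [AddCommGroup A] [DecidableEq A] [Group G] {S T U : Finset G}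

/-- **Shifted disjointness 1**: `S₁+T₀+U_k` misses the `c₀`-translate of `S₀+T₁+U_k` (the relation
`τa (ρa')⁻¹ · τb' (ρb)⁻¹ · u u'⁻¹ = ρ(c₀ + (a'+b'+c') − (a+b+c))`). [folklore] -/
theorem shifted_disjoint₁' (hρρ : ∀ a b, ρ a * ρ b = ρ (a + b))
    (hτρ : ∀ a b, τ a * ρ b = τ (a + b)) (hττ : ∀ a b, τ a * τ b = ρ (c₀ + b - a)) (hne : ∀ a b, ρ a ≠ τ b)
    (h : TripleProductProperty S T U) (k : Bool) {X Y Z X' Y' : Finset A}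
    (hX : ∀ a ∈ X, τ a ∈ S) (hY : ∀ b ∈ Y, ρ b ∈ T) (hZ : ∀ c ∈ Z, cond k (τ c) (ρ c) ∈ U)
    (hX' : ∀ a ∈ X', ρ a ∈ S) (hY' : ∀ b ∈ Y', τ b ∈ T) :
    Disjoint ((X ×ˢ Y ×ˢ Z).image fun p : A × A × A => p.1 + p.2.1 + p.2.2)
      (((X' ×ˢ Y' ×ˢ Z).image fun p : A × A × A => p.1 + p.2.1 + p.2.2).image fun x => x + c₀) := by
  rw [disjoint_left]
  intro x hx hx'
  rw [mem_sumset₃] at hx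
  obtain ⟨a, ha, b, hb, c, hc, rfl⟩ := hx
  obtain ⟨y, hy, hyx⟩ := mem_image.1 hx'
  rw [mem_sumset₃] at hy
  obtain ⟨a', ha', b', hb', c', hc', rfl⟩ := hy
  have key : τ a * (ρ a')⁻¹ * (τ b' * (ρ b)⁻¹) * (cond k (τ c) (ρ c') * (cond k (τ c') (ρ c))⁻¹) = 1 := by
    rw [cond_mul_cond_inv' hρρ hττ, inv_rho hρρ, inv_rho hρρ, hτρ, hτρ, hττ, hρρ, ← rho_zero hρρ]
    congr 1
    rw [show c₀ + (b' + -b) - (a + -a') + (c' - c) = a' + b' + c' + c₀ - (a + b + c) by abel]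
    exact sub_eq_zero.mpr hyx
  obtain ⟨h1, -, -⟩ := h _ (hX a ha) _ (hX' a' ha') _ (hY' b' hb') _ (hY b hb)
    _ (cond_mem_fst' (hZ c' hc') (hZ c hc)) _ (cond_mem_snd' (hZ c' hc') (hZ c hc)) key
  exact hne _ _ h1.symm

/-- **Shifted disjointness 2**: `S_i+T₁+U₀` misses the `c₀`-translate of `S_i+T₀+U₁`. [folklore] -/
theorem shifted_disjoint₂' (hρρ : ∀ a b, ρ a * ρ b = ρ (a + b)) (hρτ : ∀ a b, ρ a * τ b = τ (b - a))
    (hτρ : ∀ a b, τ a * ρ b = τ (a + b)) (hττ : ∀ a b, τ a * τ b = ρ (c₀ + b - a)) (hne : ∀ a b, ρ a ≠ τ b)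
    (h : TripleProductProperty S T U) (i : Bool) {X Y Z X' Y' Z' : Finset A}
    (hX : ∀ a ∈ X, cond i (τ a) (ρ a) ∈ S) (hY : ∀ b ∈ Y, τ b ∈ T) (hZ : ∀ c ∈ Z, ρ c ∈ U)
    (hX' : ∀ a ∈ X', cond i (τ a) (ρ a) ∈ S) (hY' : ∀ b ∈ Y', ρ b ∈ T) (hZ' : ∀ c ∈ Z', τ c ∈ U) :
    Disjoint ((X ×ˢ Y ×ˢ Z).image fun p : A × A × A => p.1 + p.2.1 + p.2.2)
      (((X' ×ˢ Y' ×ˢ Z').image fun p : A × A × A => p.1 + p.2.1 + p.2.2).image fun x => x + c₀) := by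
  rw [disjoint_left]
  intro x hx hx'
  rw [mem_sumset₃] at hx
  obtain ⟨a, ha, b, hb, c, hc, rfl⟩ := hx
  obtain ⟨y, hy, hyx⟩ := mem_image.1 hx'
  rw [mem_sumset₃] at hy
  obtain ⟨a', ha', b', hb', c', hc', rfl⟩ := hy
  have key : cond i (τ a) (ρ a') * (cond i (τ a') (ρ a))⁻¹ * (τ b * (ρ b')⁻¹) * (τ c' * (ρ c)⁻¹) = 1 := by
    rw [cond_mul_cond_inv' hρρ hττ, inv_rho hρρ, inv_rho hρρ, hτρ, hτρ, hρτ, hττ, ← rho_zero hρρ]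
    congr 1
    rw [show c₀ + (c' + -c) - (b + -b' - (a' - a)) = a' + b' + c' + c₀ - (a + b + c) by abel]
    exact sub_eq_zero.mpr hyx
  obtain ⟨-, h2, -⟩ := h _ (cond_mem_fst' (hX' a' ha') (hX a ha)) _ (cond_mem_snd' (hX' a' ha') (hX a ha))
    _ (hY b hb) _ (hY' b' hb') _ (hZ' c' hc') _ (hZ c hc) key
  exact hne _ _ h2.symm

/-- **Shifted disjointness 3**: `S₁+T_j+U₀` misses the `c₀`-translate of `S₀+T_j+U₁`. [folklore] -/
theorem shifted_disjoint₃' (hρρ : ∀ a b, ρ a * ρ b = ρ (a + b))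
    (hτρ : ∀ a b, τ a * ρ b = τ (a + b)) (hττ : ∀ a b, τ a * τ b = ρ (c₀ + b - a)) (hne : ∀ a b, ρ a ≠ τ b)
    (h : TripleProductProperty S T U) (j : Bool) {X Y Z X' Z' : Finset A}
    (hX : ∀ a ∈ X, ρ a ∈ S) (hY : ∀ b ∈ Y, cond j (τ b) (ρ b) ∈ T) (hZ : ∀ c ∈ Z, τ c ∈ U)
    (hX' : ∀ a ∈ X', τ a ∈ S) (hZ' : ∀ c ∈ Z', ρ c ∈ U) :
    Disjoint ((X' ×ˢ Y ×ˢ Z').image fun p : A × A × A => p.1 + p.2.1 + p.2.2)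
      (((X ×ˢ Y ×ˢ Z).image fun p : A × A × A => p.1 + p.2.1 + p.2.2).image fun x => x + c₀) := by
  rw [disjoint_left]
  intro x hx hx'
  rw [mem_sumset₃] at hx
  obtain ⟨a', ha', b', hb', c', hc', rfl⟩ := hx
  obtain ⟨y, hy, hyx⟩ := mem_image.1 hx'
  rw [mem_sumset₃] at hy
  obtain ⟨a, ha, b, hb, c, hc, rfl⟩ := hy
  have key : τ a' * (ρ a)⁻¹ * (cond j (τ b) (ρ b') * (cond j (τ b') (ρ b))⁻¹) * (τ c * (ρ c')⁻¹) = 1 := by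
    rw [cond_mul_cond_inv' hρρ hττ, inv_rho hρρ, inv_rho hρρ, hτρ, hτρ, hτρ, hττ, ← rho_zero hρρ]
    congr 1
    rw [show c₀ + (c + -c') - (a' + -a + (b' - b)) = a + b + c + c₀ - (a' + b' + c') by abel]
    exact sub_eq_zero.mpr hyx
  obtain ⟨h1, -, -⟩ := h _ (hX' a' ha') _ (hX a ha) _ (cond_mem_fst' (hY b' hb') (hY b hb))
    _ (cond_mem_snd' (hY b' hb') (hY b hb)) _ (hZ c hc) _ (hZ' c' hc') key
  exact hne _ _ h1.symm

end Shifted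

/-! ## `c₀`-saturations and `c₀`-periodic sets (`2c₀ = 0`) -/

section Saturation

variable [AddCommGroup A] [DecidableEq A]

omit [DecidableEq A] in
/-- `x + c₀ + c₀ = x` when `2c₀ = 0`. [folklore] -/
theorem shift_shift (h2 : c₀ + c₀ = 0) (x : A) : x + c₀ + c₀ = x := by
  rw [add_assoc, h2, add_zero]

/-- The saturation `X ∪ (X + c₀)` is `c₀`-periodic. [folklore] -/
theorem image_shift_sat (h2 : c₀ + c₀ = 0) (X : Finset A) :
    (X ∪ X.image fun x => x + c₀).image (fun x => x + c₀) = X ∪ X.image fun x => x + c₀ := by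
  rw [image_union, image_image]
  have hid : ((fun x => x + c₀) ∘ fun x => x + c₀ : A → A) = id := by
    funext x
    exact shift_shift h2 x
  rw [hid, image_id, union_comm]

/-- A set whose saturation is no larger than itself is `c₀`-periodic. [folklore] -/
theorem periodic_of_card_sat_eq {c₀ : A} {X : Finset A} (h : (X ∪ X.image fun x => x + c₀).card = X.card) :
    X.image (fun x => x + c₀) = X := by
  have hsub : X = X ∪ X.image (fun x => x + c₀) := eq_of_subset_of_card_le subset_union_left h.le
  have h1 : X.image (fun x => x + c₀) ⊆ X := by
    intro y hy
    rw [hsub]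
    exact mem_union_right _ hy
  exact eq_of_subset_of_card_le h1 (by rw [card_image_of_injective _ (add_left_injective c₀)])

/-- A set whose saturation has exactly one more element is a periodic set minus one point. [folklore] -/
theorem exists_insert_of_card_sat {c₀ : A} {X : Finset A}
    (h : (X ∪ X.image fun x => x + c₀).card = X.card + 1) :
    ∃ d, d ∉ X ∧ (X ∪ X.image fun x => x + c₀) = insert d X := by
  have hsd : ((X ∪ X.image fun x => x + c₀) \ X).card = 1 := by
    rw [card_sdiff_of_subset subset_union_left, h]; omega
  obtain ⟨d, hd⟩ := card_eq_one.1 hsd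
  have hdmem : d ∈ (X ∪ X.image fun x => x + c₀) \ X := by rw [hd]; exact mem_singleton_self d
  rw [mem_sdiff] at hdmem
  refine ⟨d, hdmem.2, ?_⟩
  rw [← union_sdiff_of_subset (subset_union_left (s₁ := X) (s₂ := X.image fun x => x + c₀)), hd, union_comm]
  rfl

/-- The saturation is at least as large as the set. [folklore] -/
theorem card_le_card_sat {c₀ : A} (X : Finset A) : X.card ≤ (X ∪ X.image fun x => x + c₀).card :=
  card_le_card subset_union_left

/-- A `c₀`-periodic finite set has even cardinality (`2c₀ = 0 ≠ c₀`: the translation is a fixed-point-free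
involution). [folklore] -/
theorem even_card_of_periodic (h2 : c₀ + c₀ = 0) (hc : c₀ ≠ 0) (X : Finset A)
    (hX : X.image (fun x => x + c₀) = X) : Even X.card := by
  induction X using Finset.strongInduction with
  | H X ih =>
    rcases X.eq_empty_or_nonempty with rfl | ⟨x, hx⟩
    · exact ⟨0, rfl⟩
    · have hx' : x + c₀ ∈ X := by rw [← hX]; exact mem_image_of_mem _ hx
      have hne : x + c₀ ≠ x := fun h => hc (by simpa using h)
      set Y : Finset A := (X.erase x).erase (x + c₀) with hYdef
      have hYsub : Y ⊂ X :=
        lt_of_le_of_lt (erase_subset _ _) (erase_ssubset hx)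
      have hmemY : ∀ y, y ∈ Y ↔ y ∈ X ∧ y ≠ x ∧ y ≠ x + c₀ := by
        intro y; simp only [hYdef, mem_erase]; tauto
      have hYper : Y.image (fun y => y + c₀) = Y := by
        apply eq_of_subset_of_card_le
        · intro z hz
          obtain ⟨y, hy, rfl⟩ := mem_image.1 hz
          obtain ⟨hyX, hyx, hyx'⟩ := (hmemY y).1 hy
          refine (hmemY _).2 ⟨by rw [← hX]; exact mem_image_of_mem _ hyX, fun h => hyx' ?_, fun h => hyx ?_⟩
          · rw [← h, shift_shift h2]
          · exact add_right_cancel h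
        · rw [card_image_of_injective _ (add_left_injective c₀)]
      have hcard : X.card = Y.card + 2 := by
        have h1 : (X.erase x).card + 1 = X.card := card_erase_add_one hx
        have hx'' : x + c₀ ∈ X.erase x := mem_erase.2 ⟨hne, hx'⟩
        have h2' : Y.card + 1 = (X.erase x).card := card_erase_add_one hx''
        omega
      obtain ⟨k, hk⟩ := ih Y hYsub hYper
      exact ⟨k + 1, by omega⟩

/-- Two sets that are disjoint and disjoint from each other's `c₀`-translate have disjoint saturations
(`2c₀ = 0`). [folklore] -/
theorem disjoint_sat (h2 : c₀ + c₀ = 0) {P Q : Finset A} (hPQ : Disjoint P Q)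
    (hPQ' : Disjoint P (Q.image fun x => x + c₀)) :
    Disjoint (P ∪ P.image fun x => x + c₀) (Q ∪ Q.image fun x => x + c₀) := by
  rw [disjoint_union_left, disjoint_union_right, disjoint_union_right]
  refine ⟨⟨hPQ, hPQ'⟩, ?_, (disjoint_image (add_left_injective c₀)).2 hPQ⟩
  rw [disjoint_left] at hPQ' ⊢
  intro y hy hyQ
  obtain ⟨p, hp, rfl⟩ := mem_image.1 hy
  exact hPQ' hp (mem_image.2 ⟨p + c₀, hyQ, shift_shift h2 p⟩)

/-- Three sets with pairwise disjoint saturations: the saturations have total size at most `|A|`. [folklore] -/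
theorem card_sat_add_le [Fintype A] {P Q R : Finset A}
    (hPQ : Disjoint (P ∪ P.image fun x => x + c₀) (Q ∪ Q.image fun x => x + c₀))
    (hPR : Disjoint (P ∪ P.image fun x => x + c₀) (R ∪ R.image fun x => x + c₀))
    (hQR : Disjoint (Q ∪ Q.image fun x => x + c₀) (R ∪ R.image fun x => x + c₀)) :
    (P ∪ P.image fun x => x + c₀).card + (Q ∪ Q.image fun x => x + c₀).card +
      (R ∪ R.image fun x => x + c₀).card ≤ Fintype.card A := by
  rw [← card_union_of_disjoint hPQ, ← card_union_of_disjoint (disjoint_union_left.2 ⟨hPR, hQR⟩)]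
  exact card_le_univ _

end Saturation

/-! ## The saturated triangle constraints of a TPP triple -/

section Triangles

variable [AddCommGroup A] [DecidableEq A] [Fintype A] [Group G] {S T U : Finset G}

/-- **Saturated triangles.** For a TPP triple of a dihedral-like group with `2c₀ = 0`, the `c₀`-saturations of the
three parts of each sumset triangle are pairwise disjoint, hence have total size `≤ |A|` — for both triangles
`{S₁+T₀+U₀, S₀+T₁+U₀, S₀+T₀+U₁}` and `{S₀+T₁+U₁, S₁+T₀+U₁, S₁+T₁+U₀}`. [folklore] -/
theorem sat_counting' (hρρ : ∀ a b, ρ a * ρ b = ρ (a + b)) (hρτ : ∀ a b, ρ a * τ b = τ (b - a))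
    (hτρ : ∀ a b, τ a * ρ b = τ (a + b)) (hττ : ∀ a b, τ a * τ b = ρ (c₀ + b - a)) (hne : ∀ a b, ρ a ≠ τ b)
    (h2 : c₀ + c₀ = 0) (h : TripleProductProperty S T U) {S₀ S₁ T₀ T₁ U₀ U₁ : Finset A}
    (mS₀ : ∀ a ∈ S₀, ρ a ∈ S) (mS₁ : ∀ a ∈ S₁, τ a ∈ S) (mT₀ : ∀ a ∈ T₀, ρ a ∈ T) (mT₁ : ∀ a ∈ T₁, τ a ∈ T)
    (mU₀ : ∀ a ∈ U₀, ρ a ∈ U) (mU₁ : ∀ a ∈ U₁, τ a ∈ U) :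
    (((S₁ ×ˢ T₀ ×ˢ U₀).image fun p : A × A × A => p.1 + p.2.1 + p.2.2) ∪
        ((S₁ ×ˢ T₀ ×ˢ U₀).image fun p : A × A × A => p.1 + p.2.1 + p.2.2).image fun x => x + c₀).card +
      (((S₀ ×ˢ T₁ ×ˢ U₀).image fun p : A × A × A => p.1 + p.2.1 + p.2.2) ∪
        ((S₀ ×ˢ T₁ ×ˢ U₀).image fun p : A × A × A => p.1 + p.2.1 + p.2.2).image fun x => x + c₀).card +
      (((S₀ ×ˢ T₀ ×ˢ U₁).image fun p : A × A × A => p.1 + p.2.1 + p.2.2) ∪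
        ((S₀ ×ˢ T₀ ×ˢ U₁).image fun p : A × A × A => p.1 + p.2.1 + p.2.2).image fun x => x + c₀).card ≤
      Fintype.card A ∧
    (((S₀ ×ˢ T₁ ×ˢ U₁).image fun p : A × A × A => p.1 + p.2.1 + p.2.2) ∪
        ((S₀ ×ˢ T₁ ×ˢ U₁).image fun p : A × A × A => p.1 + p.2.1 + p.2.2).image fun x => x + c₀).card +
      (((S₁ ×ˢ T₀ ×ˢ U₁).image fun p : A × A × A => p.1 + p.2.1 + p.2.2) ∪
        ((S₁ ×ˢ T₀ ×ˢ U₁).image fun p : A × A × A => p.1 + p.2.1 + p.2.2).image fun x => x + c₀).card +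
      (((S₁ ×ˢ T₁ ×ˢ U₀).image fun p : A × A × A => p.1 + p.2.1 + p.2.2) ∪
        ((S₁ ×ˢ T₁ ×ˢ U₀).image fun p : A × A × A => p.1 + p.2.1 + p.2.2).image fun x => x + c₀).card ≤
      Fintype.card A := by
  have mS₀' : ∀ a ∈ S₀, cond false (τ a) (ρ a) ∈ S := fun a ha => by simpa using mS₀ a ha
  have mS₁' : ∀ a ∈ S₁, cond true (τ a) (ρ a) ∈ S := fun a ha => by simpa using mS₁ a ha
  have mT₀' : ∀ a ∈ T₀, cond false (τ a) (ρ a) ∈ T := fun a ha => by simpa using mT₀ a ha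
  have mT₁' : ∀ a ∈ T₁, cond true (τ a) (ρ a) ∈ T := fun a ha => by simpa using mT₁ a ha
  have mU₀' : ∀ a ∈ U₀, cond false (τ a) (ρ a) ∈ U := fun a ha => by simpa using mU₀ a ha
  have mU₁' : ∀ a ∈ U₁, cond true (τ a) (ρ a) ∈ U := fun a ha => by simpa using mU₁ a ha
  have d₁ := disjoint_sumset₁' hρρ hρτ hτρ hττ hne h
  have d₂ := disjoint_sumset₂' hρρ hρτ hτρ hττ hne h
  have d₃ := disjoint_sumset₃' hρρ hρτ hτρ hττ hne h
  have e₁ := shifted_disjoint₁' hρρ hτρ hττ hne h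
  have e₂ := shifted_disjoint₂' hρρ hρτ hτρ hττ hne h
  have e₃ := shifted_disjoint₃' hρρ hτρ hττ hne h
  refine ⟨card_sat_add_le ?_ ?_ ?_, card_sat_add_le ?_ ?_ ?_⟩
  · exact disjoint_sat h2 (d₁ false mS₁ mT₀ mU₀' mS₀ mT₁) (e₁ false mS₁ mT₀ mU₀' mS₀ mT₁)
  · exact disjoint_sat h2 (d₃ false mS₀ mT₀' mU₁ mS₁ mU₀).symm (e₃ false mS₀ mT₀' mU₁ mS₁ mU₀)
  · exact disjoint_sat h2 (d₂ false mS₀' mT₁ mU₀ mS₀' mT₀ mU₁) (e₂ false mS₀' mT₁ mU₀ mS₀' mT₀ mU₁)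
  · exact (disjoint_sat h2 (d₁ true mS₁ mT₀ mU₁' mS₀ mT₁) (e₁ true mS₁ mT₀ mU₁' mS₀ mT₁)).symm
  · exact (disjoint_sat h2 (d₃ true mS₀ mT₁' mU₁ mS₁ mU₀).symm (e₃ true mS₀ mT₁' mU₁ mS₁ mU₀)).symm
  · exact (disjoint_sat h2 (d₂ true mS₁' mT₁ mU₀ mS₁' mT₀ mU₁) (e₂ true mS₁' mT₁ mU₀ mS₁' mT₀ mU₁)).symm

end Triangles

end DihedralLike

end Summit.MatrixMultiplication.OmegaCensus
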